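import Summits.HodgeConjecture.HodgeConjecture.Theorems.Ring2HypothesesDescentMotivatedKunnethSl2
import HarnessLib

/-!
# Ring 2 hypotheses, descent face — the `𝔰𝔩₂` relation `[L_θ, Λ₁ ⊗ 1 + 1 ⊗ Λ₂] = deg - n₁ - n₂` on a
# product `X₁ ⊗ X₂` for the exterior sum `θ = η₁ ⊠ 1 + 1 ⊠ η₂` (real carriers)

research route conditional on HC_CM; not a corollary; Q11.4-sentence-2 already refuted in dim ≥ 3.
Cell `pub-hodge-ring2` (Hodge ladder STAGE 3), seat `ring2-b05` (binder row b05), gen 34. `HC_CM` does not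
occur in this file; nothing here proves a case of the Hodge conjecture.

Step 3a of the port of the elementary `𝔰𝔩₂` argument (Kleiman 1968 Thm. 2.9; André 1996 §1.3; the tree's
abstract `Motives/StandardConjecturesKunnethSl2Proofs.prod_lefschetzPow_bijective`) to singular cohomology.
For `X₁`, `X₂` smooth projective complex varieties of dimensions `n₁`, `n₂` and classes `η₁`, `η₂` with the
hard Lefschetz property in dimensions `n₁`, `n₂`, the exterior sum `θ = fst^* η₁ + snd^* η₂ ∈ H²((X₁ ⊗ X₂)(ℂ); ℂ)`
has the hard Lefschetz property in dimension `n₁ + n₂`; in particular **the exterior sum of two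
polarisation classes is a polarisation class** (`IsPolarizationClass`, André 1996 §1.1) — the input of
André's Prop. 2.1 (ii), first inclusion, that the real carriers lacked
(`Theorems/HeckePrymWeilSummitOffWeilSectorMotivatedPullbackFstBelowMiddle`, module docstring; on the
abstract side it is the AXIOM `PreWeilCohomology.HasProdHyperplaneClasses` of `Motives/MotivatedCycles`).

This file: `prod_sl2_lefschetz_lowering_sub`, `prod_sl2_lowering_lefschetz_of_le_one` — the `𝔰𝔩₂` relation
`[L_θ, Λ₁₂] = deg - n₁ - n₂` on `H•((X₁ ⊗ X₂)(ℂ))` for the transported lowering operator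
`Λ₁₂ = Λ₁ ⊗ 1 + 1 ⊗ Λ₂` of `exists_kunnethLowering` (checked on cross products by Künneth induction, where
`L_θ = L₁ ⊗ 1 + 1 ⊗ L₂`, `lefschetzPowTo_boxSum_cross`, reduces it to the relations on the factors,
`sl2_lefschetz_lowering_sub`), when `Λ₁`, `Λ₂` satisfy the string formulas of `exists_sl2Lowering`. The hard
Lefschetz property of `θ` follows in the sequel `Ring2HypothesesDescentMotivatedExteriorSumHardLefschetz`.

No definition, no named fact, no sorry.

References: Kleiman1968AlgebraicCycles (§1.4 (1.4.6), Thm. 2.9), Andre1996Motifs (§1.1 p. 10, §1.3 pp. 12–13),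
VoisinHodgeI2002 (§6.2.3 Thm. 6.25), HatcherAT2002 (§3.2 Thm. 3.16, §3.3 Cor. 3.37).
-/

noncomputable section

-- every declaration of this problem lives in `Summit.HodgeConjecture.HodgeConjecture.…` (summit = sub-problem)
set_option linter.dupNamespace false

open CategoryTheory AlgebraicGeometry MonoidalCategory CartesianMonoidalCategory
open Literature.AlgebraicTopology.SingularHomology Literature.Geometry.Kaehler
open Literature.AlgebraicGeometry Literature.AlgebraicGeometry.Motives
  Literature.AlgebraicGeometry.HodgeTheory

namespace Summit.HodgeConjecture.HodgeConjecture.Theorems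

variable {n₁ n₂ : ℕ} {X₁ X₂ : SchemeOver ℂ}

/-! ## §1 The `𝔰𝔩₂` relation on the product -/

section Relation

variable {η₁ : complexBetti X₁ 2} {η₂ : complexBetti X₂ 2}
  (hv₁ : ∀ m, 2 * n₁ < m → Subsingleton (complexBetti X₁ m))
  (hv₂ : ∀ m, 2 * n₂ < m → Subsingleton (complexBetti X₂ m))
  (Λ₁ : (a b : ℕ) → complexBetti X₁ a →ₗ[ℂ] complexBetti X₁ b)
  (hS₁ : ∀ (a t i j : ℕ) (h₁ : a + 2 * (t + 1) = i) (h₂ : a + 2 * t = j) (x : complexBetti X₁ a),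
    x ∈ primitiveClasses η₁ n₁ a →
      Λ₁ i j (lefschetzPowTo η₁ (t + 1) a i h₁ x) =
        ((((t : ℤ) + 1) * ((n₁ : ℤ) - a - t) : ℤ) : ℂ) • lefschetzPowTo η₁ t a j h₂ x)
  (hP₁ : ∀ (a b : ℕ) (x : complexBetti X₁ a), x ∈ primitiveClasses η₁ n₁ a → Λ₁ a b x = 0)
  (Λ₂ : (a b : ℕ) → complexBetti X₂ a →ₗ[ℂ] complexBetti X₂ b)
  (hS₂ : ∀ (a t i j : ℕ) (h₁ : a + 2 * (t + 1) = i) (h₂ : a + 2 * t = j) (x : complexBetti X₂ a),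
    x ∈ primitiveClasses η₂ n₂ a →
      Λ₂ i j (lefschetzPowTo η₂ (t + 1) a i h₁ x) =
        ((((t : ℤ) + 1) * ((n₂ : ℤ) - a - t) : ℤ) : ℂ) • lefschetzPowTo η₂ t a j h₂ x)
  (hP₂ : ∀ (a b : ℕ) (x : complexBetti X₂ a), x ∈ primitiveClasses η₂ n₂ a → Λ₂ a b x = 0)
  (Λ : (m m' : ℕ) → complexBetti (X₁ ⊗ X₂) m →ₗ[ℂ] complexBetti (X₁ ⊗ X₂) m')
  (hΛ : ∀ (i j m m' i' j' : ℕ) (h : i + j = m) (_ : i' + 2 = i) (_ : j' + 2 = j) (h₁ : i' + j = m')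
    (h₂ : i + j' = m') (a : complexBetti X₁ i) (b : complexBetti X₂ j),
    Λ m m' (cupProduct h (complexBetti.map (fst X₁ X₂) i a) (complexBetti.map (snd X₁ X₂) j b)) =
      cupProduct h₁ (complexBetti.map (fst X₁ X₂) i' (Λ₁ i i' a)) (complexBetti.map (snd X₁ X₂) j b) +
        cupProduct h₂ (complexBetti.map (fst X₁ X₂) i a) (complexBetti.map (snd X₁ X₂) j' (Λ₂ j j' b)))
  (hΛl : ∀ (i j m m' j' : ℕ) (h : i + j = m) (_ : m' + 2 = m) (_ : i ≤ 1) (_ : j' + 2 = j) (h₂ : i + j' = m')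
    (a : complexBetti X₁ i) (b : complexBetti X₂ j),
    Λ m m' (cupProduct h (complexBetti.map (fst X₁ X₂) i a) (complexBetti.map (snd X₁ X₂) j b)) =
      cupProduct h₂ (complexBetti.map (fst X₁ X₂) i a) (complexBetti.map (snd X₁ X₂) j' (Λ₂ j j' b)))
  (hΛr : ∀ (i j m m' i' : ℕ) (h : i + j = m) (_ : m' + 2 = m) (_ : i' + 2 = i) (_ : j ≤ 1) (h₁ : i' + j = m')
    (a : complexBetti X₁ i) (b : complexBetti X₂ j),
    Λ m m' (cupProduct h (complexBetti.map (fst X₁ X₂) i a) (complexBetti.map (snd X₁ X₂) j b)) =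
      cupProduct h₁ (complexBetti.map (fst X₁ X₂) i' (Λ₁ i i' a)) (complexBetti.map (snd X₁ X₂) j b))
  (hΛ0 : ∀ (i j m m' : ℕ) (h : i + j = m) (_ : m' + 2 = m) (_ : i ≤ 1) (_ : j ≤ 1)
    (a : complexBetti X₁ i) (b : complexBetti X₂ j),
    Λ m m' (cupProduct h (complexBetti.map (fst X₁ X₂) i a) (complexBetti.map (snd X₁ X₂) j b)) = 0)

/-- The `𝔰𝔩₂` relation of one factor, rearranged: `L (Λ a) = Λ (L a) + (i - n) · a` (`i ≥ 2`). [folklore] -/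
theorem sl2_lefschetz_lowering_eq {Y : Type} [TopologicalSpace Y] {κ : singularCohomology ℂ ℂ Y 2} {n : ℕ}
    (hL : HasHardLefschetzProperty κ n) (hvan : ∀ m, 2 * n < m → Subsingleton (singularCohomology ℂ ℂ Y m))
    (Λ : (a b : ℕ) → singularCohomology ℂ ℂ Y a →ₗ[ℂ] singularCohomology ℂ ℂ Y b)
    (hS : ∀ (a t i j : ℕ) (h₁ : a + 2 * (t + 1) = i) (h₂ : a + 2 * t = j) (x : singularCohomology ℂ ℂ Y a),
      x ∈ primitiveClasses κ n a →
        Λ i j (lefschetzPowTo κ (t + 1) a i h₁ x) =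
          ((((t : ℤ) + 1) * ((n : ℤ) - a - t) : ℤ) : ℂ) • lefschetzPowTo κ t a j h₂ x)
    (hP : ∀ (a b : ℕ) (x : singularCohomology ℂ ℂ Y a), x ∈ primitiveClasses κ n a → Λ a b x = 0)
    {i' i i₂ : ℕ} (hi : i' + 2 * 1 = i) (hi₂ : i + 2 * 1 = i₂) (a : singularCohomology ℂ ℂ Y i) :
    lefschetzPowTo κ 1 i' i hi (Λ i i' a) =
      Λ i₂ i (lefschetzPowTo κ 1 i i₂ hi₂ a) + ((((i : ℤ) - n) : ℤ) : ℂ) • a := by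
  rw [← sl2_lefschetz_lowering_sub hL hvan Λ hS hP hi hi₂ a]
  abel

include hv₁ hS₁ hP₁ hv₂ hS₂ hP₂ hΛ hΛl hΛr hΛ0 in
/-- **The `𝔰𝔩₂` relation on `X₁ ⊗ X₂`** for the exterior sum `θ = fst^* η₁ + snd^* η₂` and the transported
lowering operator `Λ₁₂` (Kleiman 1968, Thm. 2.9: the triple of the product is the tensor product of the
triples of the factors): if `η₁`, `η₂` have the hard Lefschetz property in dimensions `n₁`, `n₂` (with
`Hᵐ = 0` above `2nᵢ`) and `Λ₁`, `Λ₂` satisfy the string formulas of `exists_sl2Lowering`, then on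
`Hᵈ((X₁ ⊗ X₂)(ℂ); ℂ)` with `d ≥ 2` (`c + 2 = d`, `d + 2 = e`),
`L_θ (Λ₁₂ y) - Λ₁₂ (L_θ y) = (d - n₁ - n₂) · y`. Checked on cross products `a ⊠ b` (Künneth induction),
where `L_θ = L₁ ⊗ 1 + 1 ⊗ L₂` (`lefschetzPowTo_boxSum_cross`) reduces it to the relations on the factors
(`sl2_lefschetz_lowering_sub`, `sl2_lowering_lefschetz_of_le_one`). [cite: Kleiman1968AlgebraicCycles, Thm. 2.9] -/
theorem prod_sl2_lefschetz_lowering_sub (hX₁ : IsSmoothProjective n₁ X₁) (hX₂ : IsSmoothProjective n₂ X₂)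
    (hL₁ : HasHardLefschetzProperty η₁ n₁) (hL₂ : HasHardLefschetzProperty η₂ n₂)
    {c d e : ℕ} (hcd : c + 2 * 1 = d) (hde : d + 2 * 1 = e) (y : complexBetti (X₁ ⊗ X₂) d) :
    lefschetzPowTo (complexBetti.map (fst X₁ X₂) 2 η₁ + complexBetti.map (snd X₁ X₂) 2 η₂) 1 c d hcd (Λ d c y) -
        Λ e d (lefschetzPowTo (complexBetti.map (fst X₁ X₂) 2 η₁ + complexBetti.map (snd X₁ X₂) 2 η₂) 1 d e hde y) =
      ((((d : ℤ) - n₁ - n₂) : ℤ) : ℂ) • y := by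
  induction y using kunneth_span_induction hX₁ hX₂ with
  | h0 => simp
  | hadd y z hy hz => rw [map_add, map_add, map_add, map_add, smul_add, ← hy, ← hz]; abel
  | hsmul r y hy => rw [map_smul, map_smul, map_smul, map_smul, ← smul_sub, hy, smul_comm]
  | hcross i j h a b =>
    -- `L_θ (a ⊠ b) = L a ⊠ b + a ⊠ L b`
    rw [lefschetzPowTo_boxSum_cross η₁ η₂ h rfl rfl hde (by omega) (by omega) a b, map_add]
    by_cases hi : 2 ≤ i <;> by_cases hj : 2 ≤ j
    · -- `i, j ≥ 2`
      obtain ⟨i', rfl⟩ : ∃ i', i = i' + 2 := ⟨i - 2, by omega⟩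
      obtain ⟨j', rfl⟩ : ∃ j', j = j' + 2 := ⟨j - 2, by omega⟩
      rw [hΛ (i' + 2) (j' + 2) d c i' j' h rfl rfl (by omega) (by omega) a b, map_add,
        lefschetzPowTo_boxSum_cross η₁ η₂ (show i' + (j' + 2) = c by omega) rfl rfl hcd h (by omega),
        lefschetzPowTo_boxSum_cross η₁ η₂ (show i' + 2 + j' = c by omega) rfl rfl hcd (by omega) h,
        hΛ (i' + 2 + 2) (j' + 2) e d (i' + 2) j' (by omega) rfl rfl h (by omega),
        hΛ (i' + 2) (j' + 2 + 2) e d i' (j' + 2) (by omega) rfl rfl (by omega) h,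
        sl2_lefschetz_lowering_eq hL₁ hv₁ Λ₁ hS₁ hP₁ rfl rfl a, sl2_lefschetz_lowering_eq hL₂ hv₂ Λ₂ hS₂ hP₂ rfl rfl b]
      simp only [map_add, map_smul, LinearMap.add_apply, LinearMap.smul_apply]
      have hc : ((((d : ℤ) - n₁ - n₂) : ℤ) : ℂ) =
          ((((i' + 2 : ℕ) : ℤ) - n₁ : ℤ) : ℂ) + ((((j' + 2 : ℕ) : ℤ) - n₂ : ℤ) : ℂ) := by
        subst h
        push_cast
        ring
      rw [hc, add_smul]
      abel
    · -- `i ≥ 2`, `j ≤ 1`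
      obtain ⟨i', rfl⟩ : ∃ i', i = i' + 2 := ⟨i - 2, by omega⟩
      have hj' : j ≤ 1 := by omega
      rw [hΛr (i' + 2) j d c i' h (by omega) rfl hj' (by omega) a b,
        lefschetzPowTo_boxSum_cross η₁ η₂ (show i' + j = c by omega) rfl rfl hcd h (by omega),
        hΛr (i' + 2 + 2) j e d (i' + 2) (by omega) (by omega) rfl hj' h,
        hΛ (i' + 2) (j + 2) e d i' j (by omega) rfl rfl (by omega) h,
        sl2_lefschetz_lowering_eq hL₁ hv₁ Λ₁ hS₁ hP₁ rfl rfl a,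
        sl2_lowering_lefschetz_of_le_one hv₂ Λ₂ hS₂ hj' rfl b]
      simp only [map_add, map_smul, LinearMap.add_apply, LinearMap.smul_apply]
      have hc : ((((d : ℤ) - n₁ - n₂) : ℤ) : ℂ) =
          ((((i' + 2 : ℕ) : ℤ) - n₁ : ℤ) : ℂ) - (((n₂ : ℤ) - j : ℤ) : ℂ) := by
        subst h
        push_cast
        ring
      rw [hc, sub_smul]
      abel
    · -- `i ≤ 1`, `j ≥ 2`
      obtain ⟨j', rfl⟩ : ∃ j', j = j' + 2 := ⟨j - 2, by omega⟩
      have hi' : i ≤ 1 := by omega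
      rw [hΛl i (j' + 2) d c j' h (by omega) hi' rfl (by omega) a b,
        lefschetzPowTo_boxSum_cross η₁ η₂ (show i + j' = c by omega) rfl rfl hcd (by omega) h,
        hΛ (i + 2) (j' + 2) e d i j' (by omega) rfl rfl (by omega) (by omega),
        hΛl i (j' + 2 + 2) e d (j' + 2) (by omega) (by omega) hi' rfl h,
        sl2_lefschetz_lowering_eq hL₂ hv₂ Λ₂ hS₂ hP₂ rfl rfl b,
        sl2_lowering_lefschetz_of_le_one hv₁ Λ₁ hS₁ hi' rfl a]
      simp only [map_add, map_smul, LinearMap.smul_apply]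
      have hc : ((((d : ℤ) - n₁ - n₂) : ℤ) : ℂ) =
          ((((j' + 2 : ℕ) : ℤ) - n₂ : ℤ) : ℂ) - (((n₁ : ℤ) - i : ℤ) : ℂ) := by
        subst h
        push_cast
        ring
      rw [hc, sub_smul]
      abel
    · -- `i, j ≤ 1`: then `d = 2`, `c = 0`, `i = j = 1`
      have hi' : i ≤ 1 := by omega
      have hj' : j ≤ 1 := by omega
      rw [hΛ0 i j d c h (by omega) hi' hj' a b, map_zero, zero_sub,
        hΛr (i + 2) j e d i (by omega) (by omega) rfl hj' h,
        hΛl i (j + 2) e d j (by omega) (by omega) hi' rfl h,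
        sl2_lowering_lefschetz_of_le_one hv₁ Λ₁ hS₁ hi' rfl a,
        sl2_lowering_lefschetz_of_le_one hv₂ Λ₂ hS₂ hj' rfl b]
      simp only [map_smul, LinearMap.smul_apply]
      have hc : ((((d : ℤ) - n₁ - n₂) : ℤ) : ℂ) =
          -(((n₁ : ℤ) - i : ℤ) : ℂ) - (((n₂ : ℤ) - j : ℤ) : ℂ) := by
        subst h
        push_cast
        ring
      rw [hc, sub_smul, neg_smul]
      abel

include hv₁ hS₁ hv₂ hS₂ hΛl hΛr in
/-- The `𝔰𝔩₂` relation on `X₁ ⊗ X₂` in the lowest degrees `d ≤ 1` (where `Λ₁₂ = 0` on `Hᵈ`):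
`Λ₁₂ (L_θ y) = (n₁ + n₂ - d) · y`. [cite: Kleiman1968AlgebraicCycles, Thm. 2.9] -/
theorem prod_sl2_lowering_lefschetz_of_le_one (hX₁ : IsSmoothProjective n₁ X₁)
    (hX₂ : IsSmoothProjective n₂ X₂) {d e : ℕ} (hd : d ≤ 1) (hde : d + 2 * 1 = e)
    (y : complexBetti (X₁ ⊗ X₂) d) :
    Λ e d (lefschetzPowTo (complexBetti.map (fst X₁ X₂) 2 η₁ + complexBetti.map (snd X₁ X₂) 2 η₂) 1 d e hde y) =
      ((((n₁ : ℤ) + n₂ - d) : ℤ) : ℂ) • y := by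
  induction y using kunneth_span_induction hX₁ hX₂ with
  | h0 => simp
  | hadd y z hy hz => rw [map_add, map_add, smul_add, hy, hz]
  | hsmul r y hy => rw [map_smul, map_smul, hy, smul_comm]
  | hcross i j h a b =>
    have hi' : i ≤ 1 := by omega
    have hj' : j ≤ 1 := by omega
    rw [lefschetzPowTo_boxSum_cross η₁ η₂ h rfl rfl hde (by omega) (by omega) a b, map_add,
      hΛr (i + 2) j e d i (by omega) (by omega) rfl hj' h,
      hΛl i (j + 2) e d j (by omega) (by omega) hi' rfl h,
      sl2_lowering_lefschetz_of_le_one hv₁ Λ₁ hS₁ hi' rfl a,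
      sl2_lowering_lefschetz_of_le_one hv₂ Λ₂ hS₂ hj' rfl b]
    simp only [map_smul, LinearMap.smul_apply, ← add_smul]
    congr 1
    subst h
    push_cast
    ring

end Relation


end Summit.HodgeConjecture.HodgeConjecture.Theorems

end
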